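import Literature.Analysis.FluidPDE.TaoCascadeODEProofs
import Mathlib.Algebra.BigOperators.Fin
import HarnessLib

/-!
# Tao's cascade ODE with the squared modes doubled, II: the square-free structure constants
# (the split Table 1), their symmetry, cancellation and square-freeness, and the equations of
# motion they generate in swap-symmetric / antisymmetric coordinates

T. Tao, *Finite time blowup for an averaged three-dimensional Navier–Stokes equation*, J. Amer.
Math. Soc. **29** (2016) 601–674 = arXiv:1402.0290v3, §4 ((4.1)–(4.3), the shift set `S`, the
main term of (4.10)) and §6.1 (Table 1, (6.1)–(6.7)) [`Tao2016AveragedNS`]; companion of the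
tree's `TaoCascadeODEProofs.lean` (`TaoCascade.tableZero`, `taoCoeff`, `quadTerm_taoCoeff_*`,
`sum_quadTerm_mul_taoCoeff`) and of `Tao2016AveragedNS/SplitDelayCircuit.lean` (the nine-mode
square-free circuit).

HONEST FRAMING (cell harvest/h2-tao-ladder, rung 1 of a ladder of MODEL equations; RUNG1-HANDOFF
h4 / R1-b): this file writes the cell's SPLIT cascade operator — Tao's Table 1 with the modes
`X₁, X₃, X₄` of every shell doubled into swap-pairs and every square `X²` replaced by the product
of the two copies, the couplings dictated by the energy identity (`crossForm_forced`) — as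
structure constants `α` over `m = 7` modes in the sense of Tao's §4, and PROVES the finite algebra
about them: the symmetry (4.2), the cancellation (4.3), SQUARE-FREENESS (no structure constant
couples a wavelet with itself — the property forced at rung 1 by the vanishing of Tao's (3.24) on
the isosceles locus, `Tao2016.cSigma_eq_zero_of_isosceles`), the failure of square-freeness for
Tao's own Table 1, and the computation of the main terms (4.10) and of the energy flux (4.11) for
this table, both in the seven original coordinates and in the swap-symmetric / antisymmetric
coordinates `(S, Z)` — where they are, symbol by symbol, the rows (6.1♯)–(6.4♯), (6.Z1)–(6.Z3) and
the two-way flux (6.5♯) of the split ODE system (`SplitCascadeBlowupDynamics.lean`). Nothing here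
is dynamics; nothing here concerns the Navier–Stokes equations.

## Modes and coordinates

Modes of one shell: `0,…,6 = a′, a″, b, c′, c″, d′, d″` (the first seven of the nine circuit modes
of `splitDelayCircuit`; its `ã′, ã″` are `a′, a″` of the next shell). Symmetric amplitudes
`symAmp X = ((a′+a″)/√2, b, (c′+c″)/√2, (d′+d″)/√2)`, asymmetries
`asymAmp X = ((a′-a″)/√2, (c′-c″)/√2, (d′-d″)/√2)` (`1/√2` written `√2/2`).

## Contents (all proved)

* `splitTableZero`, `splitCoeff` — the same-scale rows and the three hand-off rows
  (`(d′,d″)ₙ → (a′,a″)ₙ₊₁`, two cross pumps of coupling `(1+ε₀)^{5/2}K/√2`), as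
  `Fin 7 → Fin 7 → Fin 7 → ℤ × ℤ × ℤ → ℝ`;
* `splitCoeff_symmetric`, `splitCoeff_cancelling` — (4.2) and (4.3) hold;
* `TaoCascade.IsSquareFreeCoeff`, `splitCoeff_squareFree`, `not_isSquareFreeCoeff_taoCoeff` — the
  split table couples no wavelet with itself; Tao's does (`α_{1,1,2,(0,0,0)} = ε`);
* `quadTerm_splitCoeff_0 … _6` — the main terms of (4.10) for the seven modes;
* `symAmp`, `asymAmp`, `quadTerm_splitCoeff_sym_*`, `quadTerm_splitCoeff_asym_*` — in `(S, Z)`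
  coordinates the main terms are the rows (6.1♯)–(6.4♯), (6.Z1)–(6.Z3);
* `sum_quadTerm_mul_splitCoeff` — the energy flux `∑ᵢ (main term)ᵢ·Xᵢ` is
  `ΛₙK(S_{d,n-1}² - Z_{d,n-1}²)S_{a,n} - Λₙ₊₁K(S_{d,n}² - Z_{d,n}²)S_{a,n+1}` (all same-scale cubic
  terms cancel; `2d′d″ = S_d² - Z_d²`);
* `sum_sq_eq_symAmp_asymAmp` — `∑ᵢ Xᵢ² = ∑ S² + ∑ Z²` (the change of coordinates is orthogonal).
-/

noncomputable section

open Set Finset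

namespace Literature.Analysis.FluidPDE.Tao2016AveragedNS

open TaoCascade

/-! ### The split Table 1 -/

/-- The same-scale rows (`μ = (0,0,0)`) of the **split Table 1**: structure constants
`α_{i₁,i₂,i}` over the modes `0,…,6 = a′,a″,b,c′,c″,d′,d″` of one shell, read off the square-free
circuit `splitDelayCircuit` (each monomial `γ·XₚX_q`, `p ≠ q`, of row `i` contributes
`α_{p,q,i} = α_{q,p,i} = γ/2`): clock `2ε a′a″ → b` with back-reaction `-ε a″b`, `-ε a′b`; seed
`√2ε²e^{-K¹⁰} a′a″ → c′, c″` with back-reactions `-(ε²e^{-K¹⁰}/√2) a″c`, `a′c`; split amplifier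
`ε⁻¹K¹⁰ b c″ → c′`, `ε⁻¹K¹⁰ b c′ → c″`, `-2ε⁻¹K¹⁰ c′c″ → b`; rotors `√2ε⁻² : c″ ∘ (a′,d′)`,
`c′ ∘ (a″,d″)`. Every diagonal entry `α_{p,p,i}` vanishes. [cite: Tao2016AveragedNS, §6.1 Table 1] -/
def splitTableZero (K ε : ℝ) : Fin 7 → Fin 7 → Fin 7 → ℝ :=
  ![![![0, 0, 0, 0, 0, 0, 0],
        ![0, 0, ε, Real.sqrt 2 * (ε ^ 2 * Real.exp (-K ^ 10)) / 2, Real.sqrt 2 * (ε ^ 2 * Real.exp (-K ^ 10)) / 2, 0, 0],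
        ![0, -(ε / 2), 0, 0, 0, 0, 0],
        ![0, -(Real.sqrt 2 * (ε ^ 2 * Real.exp (-K ^ 10)) / 4), 0, 0, 0, 0, 0],
        ![0, -(Real.sqrt 2 * (ε ^ 2 * Real.exp (-K ^ 10)) / 4), 0, 0, 0, Real.sqrt 2 * (ε ^ 2)⁻¹ / 2, 0],
        ![0, 0, 0, 0, 0, 0, 0],
        ![0, 0, 0, 0, 0, 0, 0]],
      ![![0, 0, ε, Real.sqrt 2 * (ε ^ 2 * Real.exp (-K ^ 10)) / 2, Real.sqrt 2 * (ε ^ 2 * Real.exp (-K ^ 10)) / 2, 0, 0],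
        ![0, 0, 0, 0, 0, 0, 0],
        ![-(ε / 2), 0, 0, 0, 0, 0, 0],
        ![-(Real.sqrt 2 * (ε ^ 2 * Real.exp (-K ^ 10)) / 4), 0, 0, 0, 0, 0, Real.sqrt 2 * (ε ^ 2)⁻¹ / 2],
        ![-(Real.sqrt 2 * (ε ^ 2 * Real.exp (-K ^ 10)) / 4), 0, 0, 0, 0, 0, 0],
        ![0, 0, 0, 0, 0, 0, 0],
        ![0, 0, 0, 0, 0, 0, 0]],
      ![![0, -(ε / 2), 0, 0, 0, 0, 0],
        ![-(ε / 2), 0, 0, 0, 0, 0, 0],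
        ![0, 0, 0, 0, 0, 0, 0],
        ![0, 0, 0, 0, (ε⁻¹ * K ^ 10) / 2, 0, 0],
        ![0, 0, 0, (ε⁻¹ * K ^ 10) / 2, 0, 0, 0],
        ![0, 0, 0, 0, 0, 0, 0],
        ![0, 0, 0, 0, 0, 0, 0]],
      ![![0, -(Real.sqrt 2 * (ε ^ 2 * Real.exp (-K ^ 10)) / 4), 0, 0, 0, 0, 0],
        ![-(Real.sqrt 2 * (ε ^ 2 * Real.exp (-K ^ 10)) / 4), 0, 0, 0, 0, 0, Real.sqrt 2 * (ε ^ 2)⁻¹ / 2],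
        ![0, 0, 0, 0, (ε⁻¹ * K ^ 10) / 2, 0, 0],
        ![0, 0, 0, 0, 0, 0, 0],
        ![0, 0, -((ε⁻¹ * K ^ 10)), 0, 0, 0, 0],
        ![0, 0, 0, 0, 0, 0, 0],
        ![0, -(Real.sqrt 2 * (ε ^ 2)⁻¹ / 2), 0, 0, 0, 0, 0]],
      ![![0, -(Real.sqrt 2 * (ε ^ 2 * Real.exp (-K ^ 10)) / 4), 0, 0, 0, Real.sqrt 2 * (ε ^ 2)⁻¹ / 2, 0],
        ![-(Real.sqrt 2 * (ε ^ 2 * Real.exp (-K ^ 10)) / 4), 0, 0, 0, 0, 0, 0],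
        ![0, 0, 0, (ε⁻¹ * K ^ 10) / 2, 0, 0, 0],
        ![0, 0, -((ε⁻¹ * K ^ 10)), 0, 0, 0, 0],
        ![0, 0, 0, 0, 0, 0, 0],
        ![-(Real.sqrt 2 * (ε ^ 2)⁻¹ / 2), 0, 0, 0, 0, 0, 0],
        ![0, 0, 0, 0, 0, 0, 0]],
      ![![0, 0, 0, 0, 0, 0, 0],
        ![0, 0, 0, 0, 0, 0, 0],
        ![0, 0, 0, 0, 0, 0, 0],
        ![0, 0, 0, 0, 0, 0, 0],
        ![-(Real.sqrt 2 * (ε ^ 2)⁻¹ / 2), 0, 0, 0, 0, 0, 0],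
        ![0, 0, 0, 0, 0, 0, 0],
        ![0, 0, 0, 0, 0, 0, 0]],
      ![![0, 0, 0, 0, 0, 0, 0],
        ![0, 0, 0, 0, 0, 0, 0],
        ![0, 0, 0, 0, 0, 0, 0],
        ![0, -(Real.sqrt 2 * (ε ^ 2)⁻¹ / 2), 0, 0, 0, 0, 0],
        ![0, 0, 0, 0, 0, 0, 0],
        ![0, 0, 0, 0, 0, 0, 0],
        ![0, 0, 0, 0, 0, 0, 0]]]

/-- **The split Table 1** as structure constants for `m = 7` (zero off the shift set): the
same-scale rows `splitTableZero` and the hand-off `(d′,d″)ₙ → (a′,a″)ₙ₊₁` by two cross pumps of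
coupling `(1+ε₀)^{5/2}K/√2` — `α_{d′,d″,a′,(0,0,1)} = α_{d″,d′,a′,(0,0,1)} = α_{d′,d″,a″,(0,0,1)} =
α_{d″,d′,a″,(0,0,1)} = (1+ε₀)^{5/2}√2K/2` and the eight back-reaction entries
`α_{d″,a,d′,(0,1,0)} = α_{a,d″,d′,(1,0,0)} = α_{d′,a,d″,(0,1,0)} = α_{a,d′,d″,(1,0,0)} = -(1+ε₀)^{5/2}√2K/4`
for `a ∈ {a′,a″}` (the square-free version of Tao's `α_{4,4,1,(0,0,1)} = (1+ε₀)^{5/2}K`,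
`α_{1,4,4,(1,0,0)} = α_{4,1,4,(0,1,0)} = -(1+ε₀)^{5/2}K/2`; on the diagonal `x′ = x″ = x/√2` the
main terms it generates are Tao's (6.1)–(6.4), `quadTerm_splitCoeff_sym_*` at `Z = 0`).
[cite: Tao2016AveragedNS, §6.1 Table 1] -/
def splitCoeff (ε₀ K ε : ℝ) (a b c : Fin 7) (μ : ℤ × ℤ × ℤ) : ℝ :=
  if μ = (0, 0, 0) then splitTableZero K ε a b c
  else if μ = (0, 0, 1) then
    (if (a = 5 ∧ b = 6 ∨ a = 6 ∧ b = 5) ∧ (c = 0 ∨ c = 1) then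
      (1 + ε₀) ^ ((5 : ℝ) / 2) * (Real.sqrt 2 * K / 2) else 0)
  else if μ = (1, 0, 0) then
    (if (a = 0 ∨ a = 1) ∧ (b = 6 ∧ c = 5 ∨ b = 5 ∧ c = 6) then
      -((1 + ε₀) ^ ((5 : ℝ) / 2) * (Real.sqrt 2 * K / 4)) else 0)
  else if μ = (0, 1, 0) then
    (if (b = 0 ∨ b = 1) ∧ (a = 6 ∧ c = 5 ∨ a = 5 ∧ c = 6) then
      -((1 + ε₀) ^ ((5 : ℝ) / 2) * (Real.sqrt 2 * K / 4)) else 0)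
  else 0

/-- The split table on the shift `(0,0,0)`. [cite: Tao2016AveragedNS, §6.1 Table 1] -/
theorem splitCoeff_shift0 (ε₀ K ε : ℝ) (a b c : Fin 7) :
    splitCoeff ε₀ K ε a b c (0, 0, 0) = splitTableZero K ε a b c := by
  rw [splitCoeff, if_pos rfl]

/-- The split table on the shift `(0,0,1)`. [cite: Tao2016AveragedNS, §6.1 Table 1] -/
theorem splitCoeff_shift3 (ε₀ K ε : ℝ) (a b c : Fin 7) :
    splitCoeff ε₀ K ε a b c (0, 0, 1) =
      if (a = 5 ∧ b = 6 ∨ a = 6 ∧ b = 5) ∧ (c = 0 ∨ c = 1) then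
        (1 + ε₀) ^ ((5 : ℝ) / 2) * (Real.sqrt 2 * K / 2) else 0 := by
  rw [splitCoeff, if_neg (by decide), if_pos rfl]

/-- The split table on the shift `(1,0,0)`. [cite: Tao2016AveragedNS, §6.1 Table 1] -/
theorem splitCoeff_shift1 (ε₀ K ε : ℝ) (a b c : Fin 7) :
    splitCoeff ε₀ K ε a b c (1, 0, 0) =
      if (a = 0 ∨ a = 1) ∧ (b = 6 ∧ c = 5 ∨ b = 5 ∧ c = 6) then
        -((1 + ε₀) ^ ((5 : ℝ) / 2) * (Real.sqrt 2 * K / 4)) else 0 := by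
  rw [splitCoeff, if_neg (by decide), if_neg (by decide), if_pos rfl]

/-- The split table on the shift `(0,1,0)`. [cite: Tao2016AveragedNS, §6.1 Table 1] -/
theorem splitCoeff_shift2 (ε₀ K ε : ℝ) (a b c : Fin 7) :
    splitCoeff ε₀ K ε a b c (0, 1, 0) =
      if (b = 0 ∨ b = 1) ∧ (a = 6 ∧ c = 5 ∨ a = 5 ∧ c = 6) then
        -((1 + ε₀) ^ ((5 : ℝ) / 2) * (Real.sqrt 2 * K / 4)) else 0 := by
  rw [splitCoeff, if_neg (by decide), if_neg (by decide), if_neg (by decide), if_pos rfl]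

/-! ### Symmetry (4.2) and cancellation (4.3) -/

/-- Symmetry of the same-scale split table, first index `0` (one row at a time keeps each
case analysis small). [cite: Tao2016AveragedNS, (4.2)] -/
private theorem splitTableZero_symm_0 (K ε : ℝ) (b c : Fin 7) :
    splitTableZero K ε b 0 c = splitTableZero K ε 0 b c := by
  fin_cases b <;> fin_cases c <;> simp [splitTableZero]

/-- Symmetry of the same-scale split table, first index `1` (one row at a time keeps each
case analysis small). [cite: Tao2016AveragedNS, (4.2)] -/
private theorem splitTableZero_symm_1 (K ε : ℝ) (b c : Fin 7) :
    splitTableZero K ε b 1 c = splitTableZero K ε 1 b c := by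
  fin_cases b <;> fin_cases c <;> simp [splitTableZero]

/-- Symmetry of the same-scale split table, first index `2` (one row at a time keeps each
case analysis small). [cite: Tao2016AveragedNS, (4.2)] -/
private theorem splitTableZero_symm_2 (K ε : ℝ) (b c : Fin 7) :
    splitTableZero K ε b 2 c = splitTableZero K ε 2 b c := by
  fin_cases b <;> fin_cases c <;> simp [splitTableZero]

/-- Symmetry of the same-scale split table, first index `3` (one row at a time keeps each
case analysis small). [cite: Tao2016AveragedNS, (4.2)] -/
private theorem splitTableZero_symm_3 (K ε : ℝ) (b c : Fin 7) :
    splitTableZero K ε b 3 c = splitTableZero K ε 3 b c := by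
  fin_cases b <;> fin_cases c <;> simp [splitTableZero]

/-- Symmetry of the same-scale split table, first index `4` (one row at a time keeps each
case analysis small). [cite: Tao2016AveragedNS, (4.2)] -/
private theorem splitTableZero_symm_4 (K ε : ℝ) (b c : Fin 7) :
    splitTableZero K ε b 4 c = splitTableZero K ε 4 b c := by
  fin_cases b <;> fin_cases c <;> simp [splitTableZero]

/-- Symmetry of the same-scale split table, first index `5` (one row at a time keeps each
case analysis small). [cite: Tao2016AveragedNS, (4.2)] -/
private theorem splitTableZero_symm_5 (K ε : ℝ) (b c : Fin 7) :
    splitTableZero K ε b 5 c = splitTableZero K ε 5 b c := by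
  fin_cases b <;> fin_cases c <;> simp [splitTableZero]

/-- Symmetry of the same-scale split table, first index `6` (one row at a time keeps each
case analysis small). [cite: Tao2016AveragedNS, (4.2)] -/
private theorem splitTableZero_symm_6 (K ε : ℝ) (b c : Fin 7) :
    splitTableZero K ε b 6 c = splitTableZero K ε 6 b c := by
  fin_cases b <;> fin_cases c <;> simp [splitTableZero]

/-- The same-scale split table is symmetric in its first two indices. [cite: Tao2016AveragedNS, (4.2)] -/
theorem splitTableZero_symm (K ε : ℝ) (a b c : Fin 7) :
    splitTableZero K ε b a c = splitTableZero K ε a b c := by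
  fin_cases a
  exacts [splitTableZero_symm_0 K ε b c, splitTableZero_symm_1 K ε b c, splitTableZero_symm_2 K ε b c,
    splitTableZero_symm_3 K ε b c, splitTableZero_symm_4 K ε b c, splitTableZero_symm_5 K ε b c,
    splitTableZero_symm_6 K ε b c]

/-- Cyclic cancellation of the same-scale split table, first index `0`. [cite: Tao2016AveragedNS, (4.3)] -/
private theorem splitTableZero_cancel_0 (K ε : ℝ) (b c : Fin 7) :
    splitTableZero K ε 0 b c + splitTableZero K ε 0 c b + splitTableZero K ε b 0 c +
      splitTableZero K ε b c 0 + splitTableZero K ε c 0 b + splitTableZero K ε c b 0 = 0 := by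
  fin_cases b <;> fin_cases c <;> simp [splitTableZero] <;> ring

/-- Cyclic cancellation of the same-scale split table, first index `1`. [cite: Tao2016AveragedNS, (4.3)] -/
private theorem splitTableZero_cancel_1 (K ε : ℝ) (b c : Fin 7) :
    splitTableZero K ε 1 b c + splitTableZero K ε 1 c b + splitTableZero K ε b 1 c +
      splitTableZero K ε b c 1 + splitTableZero K ε c 1 b + splitTableZero K ε c b 1 = 0 := by
  fin_cases b <;> fin_cases c <;> simp [splitTableZero] <;> ring

/-- Cyclic cancellation of the same-scale split table, first index `2`. [cite: Tao2016AveragedNS, (4.3)] -/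
private theorem splitTableZero_cancel_2 (K ε : ℝ) (b c : Fin 7) :
    splitTableZero K ε 2 b c + splitTableZero K ε 2 c b + splitTableZero K ε b 2 c +
      splitTableZero K ε b c 2 + splitTableZero K ε c 2 b + splitTableZero K ε c b 2 = 0 := by
  fin_cases b <;> fin_cases c <;> simp [splitTableZero] <;> ring

/-- Cyclic cancellation of the same-scale split table, first index `3`. [cite: Tao2016AveragedNS, (4.3)] -/
private theorem splitTableZero_cancel_3 (K ε : ℝ) (b c : Fin 7) :
    splitTableZero K ε 3 b c + splitTableZero K ε 3 c b + splitTableZero K ε b 3 c +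
      splitTableZero K ε b c 3 + splitTableZero K ε c 3 b + splitTableZero K ε c b 3 = 0 := by
  fin_cases b <;> fin_cases c <;> simp [splitTableZero] <;> ring

/-- Cyclic cancellation of the same-scale split table, first index `4`. [cite: Tao2016AveragedNS, (4.3)] -/
private theorem splitTableZero_cancel_4 (K ε : ℝ) (b c : Fin 7) :
    splitTableZero K ε 4 b c + splitTableZero K ε 4 c b + splitTableZero K ε b 4 c +
      splitTableZero K ε b c 4 + splitTableZero K ε c 4 b + splitTableZero K ε c b 4 = 0 := by
  fin_cases b <;> fin_cases c <;> simp [splitTableZero] <;> ring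

/-- Cyclic cancellation of the same-scale split table, first index `5`. [cite: Tao2016AveragedNS, (4.3)] -/
private theorem splitTableZero_cancel_5 (K ε : ℝ) (b c : Fin 7) :
    splitTableZero K ε 5 b c + splitTableZero K ε 5 c b + splitTableZero K ε b 5 c +
      splitTableZero K ε b c 5 + splitTableZero K ε c 5 b + splitTableZero K ε c b 5 = 0 := by
  fin_cases b <;> fin_cases c <;> simp [splitTableZero]

/-- Cyclic cancellation of the same-scale split table, first index `6`. [cite: Tao2016AveragedNS, (4.3)] -/
private theorem splitTableZero_cancel_6 (K ε : ℝ) (b c : Fin 7) :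
    splitTableZero K ε 6 b c + splitTableZero K ε 6 c b + splitTableZero K ε b 6 c +
      splitTableZero K ε b c 6 + splitTableZero K ε c 6 b + splitTableZero K ε c b 6 = 0 := by
  fin_cases b <;> fin_cases c <;> simp [splitTableZero]

/-- The same-scale split table satisfies the cyclic cancellation ((4.3) for `μ = 0`).
[cite: Tao2016AveragedNS, (4.3)] -/
theorem splitTableZero_cancel (K ε : ℝ) (a b c : Fin 7) :
    splitTableZero K ε a b c + splitTableZero K ε a c b + splitTableZero K ε b a c +
      splitTableZero K ε b c a + splitTableZero K ε c a b + splitTableZero K ε c b a = 0 := by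
  fin_cases a
  exacts [splitTableZero_cancel_0 K ε b c, splitTableZero_cancel_1 K ε b c,
    splitTableZero_cancel_2 K ε b c, splitTableZero_cancel_3 K ε b c, splitTableZero_cancel_4 K ε b c,
    splitTableZero_cancel_5 K ε b c, splitTableZero_cancel_6 K ε b c]

/-- **The split table obeys the symmetry condition (4.2).** [cite: Tao2016AveragedNS, §4 (4.2)] -/
theorem splitCoeff_symmetric (ε₀ K ε : ℝ) : IsSymmetricCoeff (splitCoeff ε₀ K ε) := by
  intro a b c μ₁ μ₂ μ₃ hμ
  simp only [mem_shiftSet_iff, Prod.mk.injEq] at hμ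
  rcases hμ with ⟨rfl, rfl, rfl⟩ | ⟨rfl, rfl, rfl⟩ | ⟨rfl, rfl, rfl⟩ | ⟨rfl, rfl, rfl⟩
  · rw [splitCoeff_shift0, splitCoeff_shift0, splitTableZero_symm]
  · rw [splitCoeff_shift1, splitCoeff_shift2]
  · rw [splitCoeff_shift2, splitCoeff_shift1]
  · rw [splitCoeff_shift3, splitCoeff_shift3]
    split_ifs <;> tauto

/-- **The split table obeys the cancellation condition (4.3).** [cite: Tao2016AveragedNS, §4 (4.3)] -/
theorem splitCoeff_cancelling (ε₀ K ε : ℝ) : IsCancellingCoeff (splitCoeff ε₀ K ε) := by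
  intro a b c μ₁ μ₂ μ₃ hμ
  simp only [mem_shiftSet_iff, Prod.mk.injEq] at hμ
  rcases hμ with ⟨rfl, rfl, rfl⟩ | ⟨rfl, rfl, rfl⟩ | ⟨rfl, rfl, rfl⟩ | ⟨rfl, rfl, rfl⟩
  · simp only [splitCoeff_shift0]
    exact splitTableZero_cancel K ε a b c
  · simp only [splitCoeff_shift1, splitCoeff_shift2, splitCoeff_shift3]
    (fin_cases a <;> fin_cases b <;> fin_cases c <;> simp) <;> ring
  · simp only [splitCoeff_shift1, splitCoeff_shift2, splitCoeff_shift3]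
    (fin_cases a <;> fin_cases b <;> fin_cases c <;> simp) <;> ring
  · simp only [splitCoeff_shift1, splitCoeff_shift2, splitCoeff_shift3]
    (fin_cases a <;> fin_cases b <;> fin_cases c <;> simp) <;> ring

/-! ### Square-freeness -/

/-- A table of structure constants over the shift set is **square-free** when no basic term couples
a wavelet with itself: `α_{i,i,j,(μ₁,μ₂,μ₃)} = 0` whenever the two inputs are the same mode at the
same scale (`μ₁ = μ₂`). In a square-free cascade operator every basic term `⟨u,ψ_{i₁,n₁}⟩⟨u,ψ_{i₂,n₂}⟩ψ`
has two DIFFERENT input wavelets — the shape forced on a dilation-free averaged Euler operator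
supported on Tao's frames by the vanishing of the coefficients (3.24) on the isosceles locus
(`Tao2016.cSigma_eq_zero_of_isosceles`). [cite: Tao2016AveragedNS, §4 (4.1) and §3.9 (3.24)] -/
def _root_.Literature.Analysis.FluidPDE.TaoCascade.IsSquareFreeCoeff {m : ℕ}
    (α : Fin m → Fin m → Fin m → ℤ × ℤ × ℤ → ℝ) : Prop :=
  ∀ (i j : Fin m) (μ : ℤ × ℤ × ℤ), μ ∈ shiftSet → μ.1 = μ.2.1 → α i i j μ = 0

/-- **The split table is square-free.** [cite: Tao2016AveragedNS, §6.1 Table 1] -/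
theorem splitCoeff_squareFree (ε₀ K ε : ℝ) : IsSquareFreeCoeff (splitCoeff ε₀ K ε) := by
  intro i j μ hμ h12
  simp only [mem_shiftSet_iff] at hμ
  rcases hμ with rfl | rfl | rfl | rfl
  · rw [splitCoeff_shift0]
    fin_cases i <;> fin_cases j <;> simp [splitTableZero]
  · simp at h12
  · simp at h12
  · rw [splitCoeff_shift3]
    split_ifs with h
    · rcases h.1 with ⟨h5, h6⟩ | ⟨h6, h5⟩ <;> rw [h5] at h6 <;> exact absurd h6 (by decide)
    · rfl

/-- **Tao's Table 1 is not square-free** (the clock `εX₁² → X₂`: `α_{1,1,2,(0,0,0)} = ε`).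
[cite: Tao2016AveragedNS, §6.1 Table 1] -/
theorem not_isSquareFreeCoeff_taoCoeff {ε₀ K ε : ℝ} (hε : ε ≠ 0) :
    ¬ IsSquareFreeCoeff (taoCoeff ε₀ K ε) := by
  intro h
  have h1 := h 0 1 (0, 0, 0) (by simp [mem_shiftSet_iff]) rfl
  rw [taoCoeff_shift0] at h1
  simp [tableZero] at h1
  exact hε h1

/-! ### The main terms (4.10) for the split table -/

section QuadTerm

variable {ε₀ : ℝ} (K ε : ℝ) (X : Fin 7 → ℤ → ℝ → ℝ) (n : ℤ) (t : ℝ)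

/-- (4.10) for `a′`: `Λₙ(-√2ε⁻²c″d′ - εa″b - (ε²e^{-K¹⁰}/√2)a″(c′+c″) + √2K d′ₙ₋₁d″ₙ₋₁)`.
[cite: Tao2016AveragedNS, §4 (4.10)] -/
theorem quadTerm_splitCoeff_0 (hε₀ : -1 < ε₀) :
    quadTerm ε₀ (splitCoeff ε₀ K ε) X 0 n t = (1 + ε₀) ^ ((5 : ℝ) * n / 2) *
      (-(Real.sqrt 2 * (ε ^ 2)⁻¹ * X 4 n t * X 5 n t) - ε * X 1 n t * X 2 n t -
        Real.sqrt 2 / 2 * (ε ^ 2 * Real.exp (-K ^ 10)) * X 1 n t * X 3 n t -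
        Real.sqrt 2 / 2 * (ε ^ 2 * Real.exp (-K ^ 10)) * X 1 n t * X 4 n t +
        Real.sqrt 2 * K * X 5 (n - 1) t * X 6 (n - 1) t) := by
  have hs := rpow_scale_pred hε₀ n
  simp [quadTerm, sum_shiftSet, Fin.sum_univ_seven, splitCoeff_shift0, splitCoeff_shift1,
    splitCoeff_shift2, splitCoeff_shift3, splitTableZero]
  linear_combination (Real.sqrt 2 * K * X 5 (n - 1) t * X 6 (n - 1) t) * hs

/-- (4.10) for `a″` (swap `′ ↔ ″` in `quadTerm_splitCoeff_0`). [cite: Tao2016AveragedNS, §4 (4.10)] -/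
theorem quadTerm_splitCoeff_1 (hε₀ : -1 < ε₀) :
    quadTerm ε₀ (splitCoeff ε₀ K ε) X 1 n t = (1 + ε₀) ^ ((5 : ℝ) * n / 2) *
      (-(Real.sqrt 2 * (ε ^ 2)⁻¹ * X 3 n t * X 6 n t) - ε * X 0 n t * X 2 n t -
        Real.sqrt 2 / 2 * (ε ^ 2 * Real.exp (-K ^ 10)) * X 0 n t * X 3 n t -
        Real.sqrt 2 / 2 * (ε ^ 2 * Real.exp (-K ^ 10)) * X 0 n t * X 4 n t +
        Real.sqrt 2 * K * X 5 (n - 1) t * X 6 (n - 1) t) := by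
  have hs := rpow_scale_pred hε₀ n
  simp [quadTerm, sum_shiftSet, Fin.sum_univ_seven, splitCoeff_shift0, splitCoeff_shift1,
    splitCoeff_shift2, splitCoeff_shift3, splitTableZero]
  linear_combination (Real.sqrt 2 * K * X 5 (n - 1) t * X 6 (n - 1) t) * hs

/-- (4.10) for `b`: `Λₙ(2ε a′a″ - 2ε⁻¹K¹⁰ c′c″)`. [cite: Tao2016AveragedNS, §4 (4.10)] -/
theorem quadTerm_splitCoeff_2 :
    quadTerm ε₀ (splitCoeff ε₀ K ε) X 2 n t = (1 + ε₀) ^ ((5 : ℝ) * n / 2) *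
      (2 * ε * X 0 n t * X 1 n t - 2 * (ε⁻¹ * K ^ 10) * X 3 n t * X 4 n t) := by
  simp [quadTerm, sum_shiftSet, Fin.sum_univ_seven, splitCoeff_shift0, splitCoeff_shift1,
    splitCoeff_shift2, splitCoeff_shift3, splitTableZero]
  ring

/-- (4.10) for `c′`: `Λₙ(√2ε²e^{-K¹⁰} a′a″ + ε⁻¹K¹⁰ b c″)`. [cite: Tao2016AveragedNS, §4 (4.10)] -/
theorem quadTerm_splitCoeff_3 :
    quadTerm ε₀ (splitCoeff ε₀ K ε) X 3 n t = (1 + ε₀) ^ ((5 : ℝ) * n / 2) *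
      (Real.sqrt 2 * (ε ^ 2 * Real.exp (-K ^ 10)) * X 0 n t * X 1 n t +
        ε⁻¹ * K ^ 10 * X 2 n t * X 4 n t) := by
  simp [quadTerm, sum_shiftSet, Fin.sum_univ_seven, splitCoeff_shift0, splitCoeff_shift1,
    splitCoeff_shift2, splitCoeff_shift3, splitTableZero]
  ring

/-- (4.10) for `c″`: `Λₙ(√2ε²e^{-K¹⁰} a′a″ + ε⁻¹K¹⁰ b c′)`. [cite: Tao2016AveragedNS, §4 (4.10)] -/
theorem quadTerm_splitCoeff_4 :
    quadTerm ε₀ (splitCoeff ε₀ K ε) X 4 n t = (1 + ε₀) ^ ((5 : ℝ) * n / 2) *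
      (Real.sqrt 2 * (ε ^ 2 * Real.exp (-K ^ 10)) * X 0 n t * X 1 n t +
        ε⁻¹ * K ^ 10 * X 2 n t * X 3 n t) := by
  simp [quadTerm, sum_shiftSet, Fin.sum_univ_seven, splitCoeff_shift0, splitCoeff_shift1,
    splitCoeff_shift2, splitCoeff_shift3, splitTableZero]
  ring

/-- (4.10) for `d′`: `Λₙ(√2ε⁻² a′c″ - (1+ε₀)^{5/2}(K/√2) d″(a′ₙ₊₁ + a″ₙ₊₁))`.
[cite: Tao2016AveragedNS, §4 (4.10)] -/
theorem quadTerm_splitCoeff_5 :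
    quadTerm ε₀ (splitCoeff ε₀ K ε) X 5 n t = (1 + ε₀) ^ ((5 : ℝ) * n / 2) *
      (Real.sqrt 2 * (ε ^ 2)⁻¹ * X 0 n t * X 4 n t -
        (1 + ε₀) ^ ((5 : ℝ) / 2) * (Real.sqrt 2 * K / 2) * X 6 n t *
          (X 0 (n + 1) t + X 1 (n + 1) t)) := by
  simp [quadTerm, sum_shiftSet, Fin.sum_univ_seven, splitCoeff_shift0, splitCoeff_shift1,
    splitCoeff_shift2, splitCoeff_shift3, splitTableZero]
  ring

/-- (4.10) for `d″`: `Λₙ(√2ε⁻² a″c′ - (1+ε₀)^{5/2}(K/√2) d′(a′ₙ₊₁ + a″ₙ₊₁))`.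
[cite: Tao2016AveragedNS, §4 (4.10)] -/
theorem quadTerm_splitCoeff_6 :
    quadTerm ε₀ (splitCoeff ε₀ K ε) X 6 n t = (1 + ε₀) ^ ((5 : ℝ) * n / 2) *
      (Real.sqrt 2 * (ε ^ 2)⁻¹ * X 1 n t * X 3 n t -
        (1 + ε₀) ^ ((5 : ℝ) / 2) * (Real.sqrt 2 * K / 2) * X 5 n t *
          (X 0 (n + 1) t + X 1 (n + 1) t)) := by
  simp [quadTerm, sum_shiftSet, Fin.sum_univ_seven, splitCoeff_shift0, splitCoeff_shift1,
    splitCoeff_shift2, splitCoeff_shift3, splitTableZero]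
  ring

end QuadTerm

/-! ### Swap-symmetric / antisymmetric coordinates -/

/-- The **symmetric amplitudes** `(S_a, b, S_c, S_d) = ((a′+a″)/√2, b, (c′+c″)/√2, (d′+d″)/√2)` of a
family of seven-mode shell amplitudes (`symPart` of `SplitDelayCircuit.lean`, shell by shell).
[cite: Tao2016AveragedNS, §5.5 (5.5)] -/
def symAmp (X : Fin 7 → ℤ → ℝ → ℝ) : Fin 4 → ℤ → ℝ → ℝ :=
  ![fun n t => Real.sqrt 2 / 2 * (X 0 n t + X 1 n t), X 2,
    fun n t => Real.sqrt 2 / 2 * (X 3 n t + X 4 n t), fun n t => Real.sqrt 2 / 2 * (X 5 n t + X 6 n t)]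

/-- The **asymmetries** `(Z_a, Z_c, Z_d) = ((a′-a″)/√2, (c′-c″)/√2, (d′-d″)/√2)` of a family of
seven-mode shell amplitudes (`asymPart`, shell by shell). [cite: Tao2016AveragedNS, §5.5 (5.5)] -/
def asymAmp (X : Fin 7 → ℤ → ℝ → ℝ) : Fin 3 → ℤ → ℝ → ℝ :=
  ![fun n t => Real.sqrt 2 / 2 * (X 0 n t - X 1 n t), fun n t => Real.sqrt 2 / 2 * (X 3 n t - X 4 n t),
    fun n t => Real.sqrt 2 / 2 * (X 5 n t - X 6 n t)]

section SZ

variable (X : Fin 7 → ℤ → ℝ → ℝ) (n : ℤ) (t : ℝ)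

/-- `S_a = (a′+a″)/√2`. [cite: Tao2016AveragedNS, §5.5 (5.5)] -/
@[simp] theorem symAmp_zero : symAmp X 0 n t = Real.sqrt 2 / 2 * (X 0 n t + X 1 n t) := rfl

/-- `S_b = b`. [cite: Tao2016AveragedNS, §5.5 (5.5)] -/
@[simp] theorem symAmp_one : symAmp X 1 n t = X 2 n t := rfl

/-- `S_c = (c′+c″)/√2`. [cite: Tao2016AveragedNS, §5.5 (5.5)] -/
@[simp] theorem symAmp_two : symAmp X 2 n t = Real.sqrt 2 / 2 * (X 3 n t + X 4 n t) := rfl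

/-- `S_d = (d′+d″)/√2`. [cite: Tao2016AveragedNS, §5.5 (5.5)] -/
@[simp] theorem symAmp_three : symAmp X 3 n t = Real.sqrt 2 / 2 * (X 5 n t + X 6 n t) := rfl

/-- `Z_a = (a′-a″)/√2`. [cite: Tao2016AveragedNS, §5.5 (5.5)] -/
@[simp] theorem asymAmp_zero : asymAmp X 0 n t = Real.sqrt 2 / 2 * (X 0 n t - X 1 n t) := rfl

/-- `Z_c = (c′-c″)/√2`. [cite: Tao2016AveragedNS, §5.5 (5.5)] -/
@[simp] theorem asymAmp_one : asymAmp X 1 n t = Real.sqrt 2 / 2 * (X 3 n t - X 4 n t) := rfl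

/-- `Z_d = (d′-d″)/√2`. [cite: Tao2016AveragedNS, §5.5 (5.5)] -/
@[simp] theorem asymAmp_two : asymAmp X 2 n t = Real.sqrt 2 / 2 * (X 5 n t - X 6 n t) := rfl

/-- `(√2)² = 2`. [folklore] -/
private theorem sqrt_two_mul_self : Real.sqrt 2 * Real.sqrt 2 = 2 :=
  Real.mul_self_sqrt (by norm_num)

/-- **The change of coordinates is orthogonal**: `∑ᵢ Xᵢ² = ∑ S² + ∑ Z²`.
[cite: Tao2016AveragedNS, §5.5 (5.5)] -/
theorem sum_sq_eq_symAmp_asymAmp :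
    ∑ i, X i n t ^ 2 = ∑ i, symAmp X i n t ^ 2 + ∑ i, asymAmp X i n t ^ 2 := by
  simp only [Fin.sum_univ_seven, Fin.sum_univ_four, Fin.sum_univ_three, symAmp_zero, symAmp_one,
    symAmp_two, symAmp_three, asymAmp_zero, asymAmp_one, asymAmp_two]
  linear_combination (-(1 / 2) * (X 0 n t ^ 2 + X 1 n t ^ 2 + X 3 n t ^ 2 + X 4 n t ^ 2 +
    X 5 n t ^ 2 + X 6 n t ^ 2)) * sqrt_two_mul_self

variable {ε₀ : ℝ} (K ε : ℝ)

/-- **(6.1♯)**: the symmetric combination of the `a′, a″` main terms is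
`Λₙ(-ε⁻²S_cS_d - εS_ab - ε²e^{-K¹⁰}S_aS_c + K S_{d,n-1}² + ε⁻²Z_cZ_d - K Z_{d,n-1}²)`.
[cite: Tao2016AveragedNS, §6.1 (6.1)] -/
theorem quadTerm_splitCoeff_sym_a (hε₀ : -1 < ε₀) :
    Real.sqrt 2 / 2 * (quadTerm ε₀ (splitCoeff ε₀ K ε) X 0 n t +
        quadTerm ε₀ (splitCoeff ε₀ K ε) X 1 n t) =
      (1 + ε₀) ^ ((5 : ℝ) * n / 2) *
        (-(ε ^ 2)⁻¹ * symAmp X 2 n t * symAmp X 3 n t - ε * symAmp X 0 n t * symAmp X 1 n t -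
          ε ^ 2 * Real.exp (-K ^ 10) * symAmp X 0 n t * symAmp X 2 n t +
          K * symAmp X 3 (n - 1) t ^ 2 +
          (ε ^ 2)⁻¹ * asymAmp X 1 n t * asymAmp X 2 n t - K * asymAmp X 2 (n - 1) t ^ 2) := by
  rw [quadTerm_splitCoeff_0 K ε X n t hε₀, quadTerm_splitCoeff_1 K ε X n t hε₀]
  simp only [symAmp_zero, symAmp_one, symAmp_two, symAmp_three, asymAmp_one, asymAmp_two]
  ring

/-- **(6.2♯)**: the `b` main term is `Λₙ(εS_a² - ε⁻¹K¹⁰S_c² - εZ_a² + ε⁻¹K¹⁰Z_c²)`.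
[cite: Tao2016AveragedNS, §6.1 (6.2)] -/
theorem quadTerm_splitCoeff_sym_b :
    quadTerm ε₀ (splitCoeff ε₀ K ε) X 2 n t = (1 + ε₀) ^ ((5 : ℝ) * n / 2) *
      (ε * symAmp X 0 n t ^ 2 - ε⁻¹ * K ^ 10 * symAmp X 2 n t ^ 2 - ε * asymAmp X 0 n t ^ 2 +
        ε⁻¹ * K ^ 10 * asymAmp X 1 n t ^ 2) := by
  rw [quadTerm_splitCoeff_2]
  simp only [symAmp_zero, symAmp_two, asymAmp_zero, asymAmp_one]
  linear_combination ((1 + ε₀) ^ ((5 : ℝ) * n / 2) * (-ε * X 0 n t * X 1 n t +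
    (ε⁻¹ * K ^ 10) * X 3 n t * X 4 n t)) * sqrt_two_mul_self

/-- **(6.3♯)**: the symmetric combination of the `c′, c″` main terms is
`Λₙ(ε²e^{-K¹⁰}S_a² + ε⁻¹K¹⁰bS_c - ε²e^{-K¹⁰}Z_a²)`. [cite: Tao2016AveragedNS, §6.1 (6.3)] -/
theorem quadTerm_splitCoeff_sym_c :
    Real.sqrt 2 / 2 * (quadTerm ε₀ (splitCoeff ε₀ K ε) X 3 n t +
        quadTerm ε₀ (splitCoeff ε₀ K ε) X 4 n t) =
      (1 + ε₀) ^ ((5 : ℝ) * n / 2) *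
        (ε ^ 2 * Real.exp (-K ^ 10) * symAmp X 0 n t ^ 2 +
          ε⁻¹ * K ^ 10 * symAmp X 1 n t * symAmp X 2 n t -
          ε ^ 2 * Real.exp (-K ^ 10) * asymAmp X 0 n t ^ 2) := by
  rw [quadTerm_splitCoeff_3, quadTerm_splitCoeff_4]
  simp only [symAmp_zero, symAmp_one, symAmp_two, asymAmp_zero]
  ring

/-- **(6.4♯)**: the symmetric combination of the `d′, d″` main terms is
`Λₙ(ε⁻²S_cS_a - (1+ε₀)^{5/2}K S_dS_{a,n+1} - ε⁻²Z_aZ_c)`. [cite: Tao2016AveragedNS, §6.1 (6.4)] -/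
theorem quadTerm_splitCoeff_sym_d :
    Real.sqrt 2 / 2 * (quadTerm ε₀ (splitCoeff ε₀ K ε) X 5 n t +
        quadTerm ε₀ (splitCoeff ε₀ K ε) X 6 n t) =
      (1 + ε₀) ^ ((5 : ℝ) * n / 2) *
        ((ε ^ 2)⁻¹ * symAmp X 2 n t * symAmp X 0 n t -
          (1 + ε₀) ^ ((5 : ℝ) / 2) * K * symAmp X 3 n t * symAmp X 0 (n + 1) t -
          (ε ^ 2)⁻¹ * asymAmp X 0 n t * asymAmp X 1 n t) := by
  rw [quadTerm_splitCoeff_5, quadTerm_splitCoeff_6]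
  simp only [symAmp_zero, symAmp_two, symAmp_three, asymAmp_zero, asymAmp_one]
  ring

/-- **(6.Z1)**: the antisymmetric combination of the `a′, a″` main terms is
`Λₙ(εbZ_a + ε²e^{-K¹⁰}S_cZ_a - ε⁻²S_cZ_d + ε⁻²S_dZ_c)` — linear in `Z`, and the incoming hand-off
cancels (the next shell is born symmetric). [cite: Tao2016AveragedNS, §6.1 (6.1)] -/
theorem quadTerm_splitCoeff_asym_a (hε₀ : -1 < ε₀) :
    Real.sqrt 2 / 2 * (quadTerm ε₀ (splitCoeff ε₀ K ε) X 0 n t -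
        quadTerm ε₀ (splitCoeff ε₀ K ε) X 1 n t) =
      (1 + ε₀) ^ ((5 : ℝ) * n / 2) *
        (ε * symAmp X 1 n t * asymAmp X 0 n t +
          ε ^ 2 * Real.exp (-K ^ 10) * symAmp X 2 n t * asymAmp X 0 n t -
          (ε ^ 2)⁻¹ * symAmp X 2 n t * asymAmp X 2 n t +
          (ε ^ 2)⁻¹ * symAmp X 3 n t * asymAmp X 1 n t) := by
  rw [quadTerm_splitCoeff_0 K ε X n t hε₀, quadTerm_splitCoeff_1 K ε X n t hε₀]
  simp only [symAmp_one, symAmp_two, symAmp_three, asymAmp_zero, asymAmp_one, asymAmp_two]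
  ring

/-- **(6.Z2)**: the antisymmetric combination of the `c′, c″` main terms is `-Λₙε⁻¹K¹⁰ b Z_c`
(the seed does not feed `Z_c`). [cite: Tao2016AveragedNS, §6.1 (6.3)] -/
theorem quadTerm_splitCoeff_asym_c :
    Real.sqrt 2 / 2 * (quadTerm ε₀ (splitCoeff ε₀ K ε) X 3 n t -
        quadTerm ε₀ (splitCoeff ε₀ K ε) X 4 n t) =
      (1 + ε₀) ^ ((5 : ℝ) * n / 2) * (-(ε⁻¹ * K ^ 10 * symAmp X 1 n t * asymAmp X 1 n t)) := by
  rw [quadTerm_splitCoeff_3, quadTerm_splitCoeff_4]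
  simp only [symAmp_one, asymAmp_one]
  ring

/-- **(6.Z3)**: the antisymmetric combination of the `d′, d″` main terms is
`Λₙ(ε⁻²S_cZ_a - ε⁻²S_aZ_c + (1+ε₀)^{5/2}K S_{a,n+1}Z_d)` — the hand-off AMPLIFIES `Z_d` while the
next input is loaded. [cite: Tao2016AveragedNS, §6.1 (6.4)] -/
theorem quadTerm_splitCoeff_asym_d :
    Real.sqrt 2 / 2 * (quadTerm ε₀ (splitCoeff ε₀ K ε) X 5 n t -
        quadTerm ε₀ (splitCoeff ε₀ K ε) X 6 n t) =
      (1 + ε₀) ^ ((5 : ℝ) * n / 2) *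
        ((ε ^ 2)⁻¹ * symAmp X 2 n t * asymAmp X 0 n t -
          (ε ^ 2)⁻¹ * symAmp X 0 n t * asymAmp X 1 n t +
          (1 + ε₀) ^ ((5 : ℝ) / 2) * K * symAmp X 0 (n + 1) t * asymAmp X 2 n t) := by
  rw [quadTerm_splitCoeff_5, quadTerm_splitCoeff_6]
  simp only [symAmp_zero, symAmp_two, asymAmp_zero, asymAmp_one, asymAmp_two]
  ring

/-- **(6.5♯): the energy flux of the split table.** By the cancellation (4.3) all same-scale
cubic terms cancel in `∑ᵢ (main term)ᵢ · X_{i,n}`, leaving the two hand-off fluxes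
`ΛₙK(S_{d,n-1}² - Z_{d,n-1}²)S_{a,n} - Λₙ₊₁K(S_{d,n}² - Z_{d,n}²)S_{a,n+1}` (`2d′d″ = S_d² - Z_d²`:
a two-way valve). [cite: Tao2016AveragedNS, §6.1 (6.5)] -/
theorem sum_quadTerm_mul_splitCoeff (hε₀ : -1 < ε₀) :
    ∑ i, quadTerm ε₀ (splitCoeff ε₀ K ε) X i n t * X i n t =
      (1 + ε₀) ^ ((5 : ℝ) * n / 2) * K *
          (symAmp X 3 (n - 1) t ^ 2 - asymAmp X 2 (n - 1) t ^ 2) * symAmp X 0 n t -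
        (1 + ε₀) ^ ((5 : ℝ) * (n + 1) / 2) * K *
          (symAmp X 3 n t ^ 2 - asymAmp X 2 n t ^ 2) * symAmp X 0 (n + 1) t := by
  have h1 := rpow_scale_succ hε₀ n
  simp only [Fin.sum_univ_seven, quadTerm_splitCoeff_0 K ε X n t hε₀,
    quadTerm_splitCoeff_1 K ε X n t hε₀, quadTerm_splitCoeff_2, quadTerm_splitCoeff_3,
    quadTerm_splitCoeff_4, quadTerm_splitCoeff_5, quadTerm_splitCoeff_6, symAmp_zero,
    symAmp_three, asymAmp_two]
  linear_combination (-(Real.sqrt 2 * K * X 5 n t * X 6 n t *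
      (X 0 (n + 1) t + X 1 (n + 1) t))) * h1 +
    (-(Real.sqrt 2 / 2) * ((1 + ε₀) ^ ((5 : ℝ) * n / 2) * K * (X 5 (n - 1) t * X 6 (n - 1) t) *
        (X 0 n t + X 1 n t) -
      (1 + ε₀) ^ ((5 : ℝ) * (n + 1) / 2) * K * (X 5 n t * X 6 n t) *
        (X 0 (n + 1) t + X 1 (n + 1) t))) * sqrt_two_mul_self

end SZ

end Literature.Analysis.FluidPDE.Tao2016AveragedNS
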